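import Mathlib
import Literature.Computability.AlgebraicComplexity.DeterminantalIdealComplexityProofs
import Summits.MatrixMultiplication.MatrixMultiplication.Theses.DeterminantalIdealExponent

/-!
# `DeterminantalIdealExponent.AndrewsLifting` (stmt-MatrixMultiplication-7709) — candidate proof (cstrat r1)

The crux is Andrews 2022 (arXiv:2208.01078) Thm. 3 at `F = ℂ`, `n = m = r`, `f = g · det_r`, in the tree's
division-free total-complexity currency; the Literature library DISCHARGES the named fact
(`Andrews2022_thm3_holds`, `DeterminantalIdealComplexityProofs.lean`) and provides the instance
`Andrews2022_thm3.andrewsLifting` in the exact shape of the crux. One term closes the item.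
Intended tree path for a prover: `Summits/MatrixMultiplication/MatrixMultiplication/Theorems/DeterminantalIdealExponentAndrewsLifting.lean`.
-/

set_option linter.dupNamespace false

namespace Summit.MatrixMultiplication.MatrixMultiplication.Theorems

open Literature.Computability.AlgebraicComplexity

/-- **Crux `AndrewsLifting` holds** (Andrews 2022, Thm. 3, proved in Literature as `Andrews2022_thm3_holds`).
[cite: Andrews2022, Thm. 3] -/
theorem determinantalIdealExponent_andrewsLifting :
    Summit.MatrixMultiplication.MatrixMultiplication.Theses.DeterminantalIdealExponent.AndrewsLifting :=
  fun r g hg => Andrews2022_thm3_holds.andrewsLifting r g hg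

end Summit.MatrixMultiplication.MatrixMultiplication.Theorems
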